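import Literature.NumberTheory.GaloisRepresentations.PhiGammaModuleRobba
import HarnessLib

/-!
# `HasRankOneClassification` is a hypothesis on the `(φ, Γ_F)`-module datum, not a theorem about it

`PhiGammaModuleRobba.HasRankOneClassification 𝓣` (file `PhiGammaModuleRobba`) renders, as a
PREDICATE on the enriched datum `𝓣 : PhiGammaModuleRobba p F E` (an abstract `(φ, Γ)`-ring with
abstract rules `D_rig`, `𝓡(δ) = charMod δ`), Kedlaya–Pottharst–Xiao's classification of rank-one
`(φ, Γ_K)`-modules over the Robba ring: every rank-one `(φ, Γ_K)`-module over `𝓡_L(π_K)` is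
`≅ 𝓡_L(π_K)(δ)` for a unique continuous character `δ : Kˣ → Lˣ` (the case `X = Max L` of
[cite: KedlayaPottharstXiao2014, Thm. 6.2.14]; for `K = ℚ_p` Colmez, in general Nakamura), together
with the multiplicativity of `δ ↦ 𝓡(δ)` [cite: KedlayaPottharstXiao2014, Construction 6.2.4] and the
continuity of the `𝓡(δ)`.  The declaration sits under `variable (𝓣 : PhiGammaModuleRobba p F E)`,
so it elaborates to `PhiGammaModuleRobba p F E → Prop`: like its siblings (`HasLiuFiniteness`,
`HasRankOneCohomology`, `HasCFTIdentification`, `HasDrigEtale` — for the last see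
`HasDrigEtaleHypothesis.lean`) it is, by the design of that file, "nothing asserted"; a route
posits `(h : 𝓣.IsKPX d)`.  In particular there is no closed proposition
`HasRankOneClassification` to discharge by a `HasRankOneClassification_holds`, and the genuine
datum (Robba ring `𝓡_E(π_F)`, Berger's `D_rig^†`, KPX's `𝓡(δ)`), for which the predicate IS KPX's
theorem, is not constructed in Mathlib or in this tree (cf. the named fact
`PhiGammaModuleData.nonempty` of `Trianguline.lean`).

This file records, sorry-free, that the predicate is moreover NOT a consequence of the axioms
bundled in `PhiGammaModuleRobba`:

* `PhiGammaModuleRobba.exists_not_hasRankOneClassification` — a degenerate datum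
  `𝓣 : PhiGammaModuleRobba 2 ℂ (ZMod 2)` with `¬ 𝓣.HasRankOneClassification`.  Over `F = ℂ` the
  group `Γ_F^abs = Gal(ℂ̄/ℂ)` is trivial (so all framed representations coincide and the `D_rig`
  axioms hold for `D_rig ≡` trivial) and `(ZMod 2)ˣ = 1` (so there is exactly one continuous
  character `ℂˣ → 𝔽₂ˣ` and `charMod_injective` holds for `𝓡(δ) ≡` trivial).  The degenerate datum
  of `HasDrigEtaleHypothesis.lean` (ring `𝔽₂`) satisfies `HasRankOneClassification` — all its
  rank-one objects are trivial — so here the ring is `𝔽₂[T, T⁻¹]` (Mathlib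
  `LaurentPolynomial (ZMod 2)`) with `φ = id`, the trivial `Γ`-action and the discrete topology:
  the framed rank-one object `(P, G) = (T, 1)` is cyclotomic and continuous, but an isomorphism
  `U ∈ GL₁` with the trivial object `𝓡(δ)` would give `1 = U⁻¹ T φ(U) = U⁻¹ T U`, i.e. `T = 1`.
  Everything is built inside the proof (no new declarations besides the theorems).
* `PhiGammaModuleRobba.not_forall_hasRankOneClassification` — hence the universal closure over all
  `(p, F, E, 𝓣)` (universe `0`, as in `PhiGammaModuleData.nonempty`) is false: the declaration is a
  parametrised hypothesis with no `_holds`, not a named fact.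

Nothing here bears on KPX's theorem itself.

## References

* K. S. Kedlaya, J. Pottharst, L. Xiao, *Cohomology of arithmetic families of `(φ, Γ)`-modules*,
  JAMS 27 (2014), arXiv:1203.5718 — Construction 6.2.4, Thm. 6.2.14. [KedlayaPottharstXiao2014]
-/

noncomputable section

namespace Literature.NumberTheory.GaloisRepresentations

open Field

namespace PhiGammaModuleRobba

/-- **A degenerate datum violating `HasRankOneClassification`.**  Over `F = ℂ` (`G_ℂ = 1`),
`E = 𝔽₂` (`𝔽₂ˣ = 1`), with `(φ, Γ)`-ring `𝔽₂[T, T⁻¹]`, `φ = id`, trivial action, discrete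
topology, `D_rig ≡ 𝓡(δ) ≡` trivial, `γ_F := 1`, `homToH1 := 0`, `IsEtale := True`: every axiom of
`PhiGammaModuleRobba 2 ℂ (ZMod 2)` holds, but the rank-one object `(P, G) = (T, 1)` is cyclotomic
and continuous and not isomorphic to the trivial object `𝓡(δ)` (`1 = U⁻¹ T φ(U)` forces `T = 1`),
contradicting the third conjunct ("every continuous rank-one `(φ, Γ_F)`-module is `≅ 𝓡(δ)`",
[cite: KedlayaPottharstXiao2014, Thm. 6.2.14] read as an axiom on the datum). [folklore] -/
theorem exists_not_hasRankOneClassification :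
    ∃ 𝓣 : PhiGammaModuleRobba.{0, 0, 0} 2 ℂ (ZMod 2), ¬ 𝓣.HasRankOneClassification := by
  -- (1) `G_ℂ = 1` (`ℂ̄ = ℂ`), so framed representations of it coincide; `𝔽₂ˣ = 1`, so continuous
  -- characters `ℂˣ → 𝔽₂ˣ` coincide.
  haveI hG : Subsingleton (absoluteGaloisGroup ℂ) := by
    refine ⟨fun σ τ => ?_⟩
    apply AlgEquiv.ext
    intro x
    obtain ⟨z, rfl⟩ :=
      (IsAlgClosed.algebraMap_bijective_of_isIntegral (k := ℂ) (K := AlgebraicClosure ℂ)).2 x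
    rw [AlgEquiv.commutes, AlgEquiv.commutes]
  haveI hχ : Subsingleton (ℂˣ →ₜ* (ZMod 2)ˣ) :=
    ⟨fun _ _ => ContinuousMonoidHom.ext fun _ => Subsingleton.elim _ _⟩
  have hρ : ∀ n : ℕ, Subsingleton (FramedGaloisRep ℂ (ZMod 2) n) := fun n =>
    ⟨fun _ _ => ContinuousMonoidHom.ext fun g => by rw [Subsingleton.elim g 1, map_one, map_one]⟩
  -- (2) A `(φ, Γ)`-ring over `𝔽₂` with `φ = id`, trivial `Γ`-action, the discrete topology and an
  -- element `≠ 1` of `GL₁`: `𝔽₂[T, T⁻¹]` with `T` (packaged existentially: only these properties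
  -- are used below).
  obtain ⟨𝓡, t𝓡, d𝓡, hsmul, hfrob, Tgl, hTgl⟩ :
      ∃ (𝓡 : PhiGammaRing.{0, 0, 0} (absoluteGaloisGroup ℂ) (ZMod 2)) (_ : TopologicalSpace 𝓡.R),
        DiscreteTopology 𝓡.R ∧ (∀ (γ : absoluteGaloisGroup ℂ) (r : 𝓡.R), γ • r = r) ∧
        (∀ r : 𝓡.R, 𝓡.frob r = r) ∧ ∃ g : GL (Fin 1) 𝓡.R, g ≠ 1 := by
    letI 𝔞 : MulSemiringAction (absoluteGaloisGroup ℂ) (LaurentPolynomial (ZMod 2)) :=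
      { smul := fun _ a => a
        one_smul := fun _ => rfl
        mul_smul := fun _ _ _ => rfl
        smul_zero := fun _ => rfl
        smul_add := fun _ _ _ => rfl
        smul_one := fun _ => rfl
        smul_mul := fun _ _ _ => rfl }
    haveI 𝔠 : SMulCommClass (absoluteGaloisGroup ℂ) (ZMod 2) (LaurentPolynomial (ZMod 2)) :=
      ⟨fun _ _ _ => rfl⟩
    -- `T ≠ 1` in `𝔽₂[T, T⁻¹]` (compare degrees)
    have hT1 : (LaurentPolynomial.T 1 : LaurentPolynomial (ZMod 2)) ≠ 1 := by
      intro h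
      have h' : (LaurentPolynomial.T 1 : LaurentPolynomial (ZMod 2)) = LaurentPolynomial.T 0 := by
        rw [LaurentPolynomial.T_zero]
        exact h
      have hd := congrArg LaurentPolynomial.degree h'
      rw [LaurentPolynomial.degree_T, LaurentPolynomial.degree_T] at hd
      exact absurd hd (by decide)
    refine ⟨{ R := LaurentPolynomial (ZMod 2)
              frob := AlgHom.id (ZMod 2) (LaurentPolynomial (ZMod 2))
              frob_smul := fun _ _ => rfl }, ⊥, @DiscreteTopology.mk _ ⊥ rfl, fun _ _ => rfl,
      fun _ => rfl,
      Units.map (Matrix.scalar (Fin 1) :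
        LaurentPolynomial (ZMod 2) →+* Matrix (Fin 1) (Fin 1) (LaurentPolynomial (ZMod 2))).toMonoidHom
        (LaurentPolynomial.isUnit_T (R := ZMod 2) 1).unit, fun h => hT1 ?_⟩
    have h00 := congrArg (fun M : GL (Fin 1) (LaurentPolynomial (ZMod 2)) =>
      (M : Matrix (Fin 1) (Fin 1) (LaurentPolynomial (ZMod 2))) 0 0) h
    simpa using h00
  letI := t𝓡
  haveI := d𝓡
  have hγ : ∀ {n : ℕ} (γ : absoluteGaloisGroup ℂ) (U : GL (Fin n) 𝓡.R), 𝓡.gammaGL n γ U = U :=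
    fun γ U => Units.ext (Matrix.ext fun i j => (𝓡.gammaGL_apply γ U i j).trans (hsmul γ _))
  have hφ : ∀ {n : ℕ} (U : GL (Fin n) 𝓡.R), 𝓡.phiGL n U = U :=
    fun U => Units.ext (Matrix.ext fun i j => (𝓡.phiGL_apply U i j).trans (hfrob _))
  -- (3) The datum: `D_rig ≡` trivial, `𝓡(δ) ≡` trivial; then its enrichment (`γ_F = 1`,
  -- `homToH1 = 0`, `IsEtale ≡ True`).
  letI 𝔇 : PhiGammaModuleData.{0, 0, 0} 2 ℂ (ZMod 2) :=
    { ring := 𝓡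
      smul_eq_self := fun σ _ r => hsmul σ r
      Drig := fun _ => FramedPhiGammaModule.trivial 𝓡 _
      Drig_matGamma_eq_one := fun _ _ _ => rfl
      Drig_conj := fun _ _ => FramedPhiGammaModule.IsIso.refl _
      Drig_injective := fun _ _ _ => ⟨1, (hρ _).elim _ _⟩
      Drig_one := fun _ => FramedPhiGammaModule.IsIso.refl _
      charMod := fun _ => FramedPhiGammaModule.trivial 𝓡 1
      charMod_matGamma_eq_one := fun _ _ _ => rfl
      charMod_one := FramedPhiGammaModule.IsIso.refl _
      charMod_injective := fun δ δ' _ => Subsingleton.elim δ δ'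
      Drig_rank_one := fun _ => ⟨1, FramedPhiGammaModule.IsIso.refl _⟩ }
  letI 𝓣 : PhiGammaModuleRobba.{0, 0, 0} 2 ℂ (ZMod 2) :=
    { toPhiGammaModuleData := 𝔇
      topR := t𝓡
      topRingR := inferInstance
      continuous_frob := continuous_of_discreteTopology
      continuous_act := fun _ => continuous_of_discreteTopology
      continuous_orbit := fun _ => continuous_of_discreteTopology
      gen := 1
      dense_gen := by
        have h : ((Subgroup.closure {(1 : absoluteGaloisGroup ℂ)} ⊔ torsionKernel 2 ℂ :
            Subgroup (absoluteGaloisGroup ℂ)) : Set (absoluteGaloisGroup ℂ)) = Set.univ :=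
          Set.eq_univ_of_forall fun x => by
            rw [Subsingleton.elim x 1]
            exact SetLike.mem_coe.2 (one_mem _)
        rw [h]
        exact dense_univ
      homToH1 := 0
      IsEtale := fun _ => True }
  -- (4) The rank-one object `L`: `φ(e) = T e`, `γ(e) = e`; cyclotomic, continuous, `≇ 𝓡(δ)`.
  letI L : FramedPhiGammaModule 𝓡 1 :=
    { matPhi := Tgl
      matGamma := fun _ => 1
      matGamma_mul := fun _ _ => by rw [map_one, mul_one]
      matPhi_mul := fun γ => by rw [map_one, mul_one, one_mul, hγ] }
  have hLcyc : 𝓣.IsCyclotomic L := fun _ _ => rfl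
  have hLcont : L.toPhiGammaModule.IsContinuous := fun _ => continuous_of_discreteTopology
  have key : ∀ U : GL (Fin 1) 𝓡.R, (1 : GL (Fin 1) 𝓡.R) ≠ U⁻¹ * Tgl * 𝓡.phiGL 1 U := by
    intro U h
    rw [hφ] at h
    apply hTgl
    have h2 : U⁻¹ * Tgl = U⁻¹ := mul_eq_one_iff_eq_inv.mp h.symm
    calc Tgl = U * (U⁻¹ * Tgl) := by rw [mul_inv_cancel_left]
      _ = 1 := by rw [h2, mul_inv_cancel]
  refine ⟨𝓣, ?_⟩
  rintro ⟨-, -, h⟩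
  obtain ⟨δ, ⟨U, hU⟩, -⟩ := h L hLcyc hLcont
  exact key U (congrArg FramedPhiGammaModule.matPhi hU)

/-- **The universal closure of `HasRankOneClassification` is false** (witness: the degenerate
datum of `exists_not_hasRankOneClassification` over `F = ℂ`, `E = ZMod 2`, `p = 2`; universe `0`
as in `PhiGammaModuleData.nonempty`).  Hence `HasRankOneClassification` — KPX's rank-one
classification [cite: KedlayaPottharstXiao2014, Thm. 6.2.14] read as an axiom on "the"
`(φ, Γ_F)`-module theory — is a parametrised hypothesis a route assumes (via `IsKPX`), with no
`_holds`, and not a named fact. [folklore] -/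
theorem not_forall_hasRankOneClassification :
    ¬ ∀ (p : ℕ) [Fact p.Prime] (F : Type) [Field F] [TopologicalSpace F] (E : Type) [Field E]
        [TopologicalSpace E] [IsTopologicalRing E] (𝓣 : PhiGammaModuleRobba.{0, 0, 0} p F E),
        𝓣.HasRankOneClassification :=
  fun h => exists_not_hasRankOneClassification.elim fun 𝓣 h𝓣 => h𝓣 (h 2 ℂ (ZMod 2) 𝓣)

end PhiGammaModuleRobba

end Literature.NumberTheory.GaloisRepresentations

end
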